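import Summits.ABC.StewartYu.PadicG3ParB
import HarnessLib

/-!
# The `p`-adic Gen-3 parameter record — part C: the box and the Siegel count (B1)

Support file (one closed form and plain theorems; no named facts). Continues `PadicG3ParB`
(K-M3.1 page HOME/p1/K-M3-1-padic-ledger.md §4 (B1)): the box half-sides `side j = ⌊L/(2 A j)⌋₊`
(Matveev's unshared box `|λⱼ| ≤ L/(2Aⱼ)`) with `(3/4)ⁿ Lⁿ/Ω ≤ ∏ (2 side j + 1)`; the elementary
`(k+1)^k ≤ e^k k!` and `C(M'+n, n) ≤ (17 e L)ⁿ` for every order bound `M' ≤ Mord 0 0`; and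
**the Siegel count (B1)** `2 (2X+1) · C(M'+n, n) · K ≤ (L₀+1) · ∏ (2 side j + 1)` — the hypothesis
`2·#eqs ≤ #unk` of `G3Setup.siegel_slab` (p2) once the frame identifies `#midx M' ≤ C(M'+n, n)` and
`∏ (2 side j + 1) ≤ K·#𝔏` (`G3Setup.exists_slab_box`, with the record instantiated at `K₀ := p − 1`).

## References
* [Nesterenko2003] Yu. V. Nesterenko, *Linear forms in logarithms of rational numbers*, LNM 1819
  (2003) 53–106 — §3.4 Prop 3.4, §3.5 (3.12), Prop 3.9, (3.48).
-/

noncomputable section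

open Finset Real

namespace Summit.ABC.StewartYu

namespace PadicG3Par

variable {n : ℕ} (P : PadicG3Par n)

/-! ### The box and the Siegel count (B1) -/

/-- the box half-sides `side j = ⌊L/(2 A j)⌋₊` (Matveev's unshared box). [cite: Nesterenko2003, (3.12)] -/
def side (j : Fin n) : ℕ := ⌊(P.L : ℝ) / (2 * P.A j)⌋₊

/-- `side j ≤ L/(2 A j)`. [folklore] -/
theorem side_le (j : Fin n) : (P.side j : ℝ) ≤ P.L / (2 * P.A j) :=
  Nat.floor_le (by have := P.A_pos j; have := P.one_le_L; positivity)

/-- `1 ≤ L/(2 A j)` (every side is at least one). [folklore] -/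
theorem one_le_L_div (j : Fin n) : (1 : ℝ) ≤ P.L / (2 * P.A j) := by
  have hA := P.A_pos j
  rw [le_div_iff₀ (by positivity)]
  have := P.hAmax j; have := P.two_Amax_le_L
  linarith

/-- `1 ≤ side j`. [folklore] -/
theorem one_le_side (j : Fin n) : 1 ≤ P.side j := by
  unfold side; exact Nat.le_floor (by exact_mod_cast P.one_le_L_div j)

/-- `(3/4) · L/A j ≤ 2 side j + 1` (the floor keeps three quarters of the side). [folklore] -/
theorem three_quarters_le (j : Fin n) : (3 / 4 : ℝ) * (P.L / P.A j) ≤ 2 * (P.side j : ℝ) + 1 := by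
  have hA := P.A_pos j
  have hy := P.one_le_L_div j
  have hk : (1 : ℝ) ≤ P.side j := by exact_mod_cast P.one_le_side j
  have hlt : (P.L : ℝ) / (2 * P.A j) < P.side j + 1 := by unfold side; exact Nat.lt_floor_add_one _
  have e : (P.L : ℝ) / P.A j = 2 * (P.L / (2 * P.A j)) := by field_simp
  rw [e]
  nlinarith

/-- **`(3/4)ⁿ · Lⁿ/Ω ≤ ∏ (2 side j + 1)`** (the box has at least `(3/4)ⁿ Lⁿ/Ω` points).
[cite: Nesterenko2003, Prop 3.4] -/
theorem prod_side_ge : (3 / 4 : ℝ) ^ n * ((P.L : ℝ) ^ n / P.Ω) ≤ ∏ j, (2 * (P.side j : ℝ) + 1) := by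
  have e : (3 / 4 : ℝ) ^ n * ((P.L : ℝ) ^ n / P.Ω) = ∏ j : Fin n, (3 / 4 : ℝ) * (P.L / P.A j) := by
    rw [prod_mul_distrib, prod_const, card_univ, Fintype.card_fin, prod_div_distrib, prod_const,
      card_univ, Fintype.card_fin]
    rfl
  rw [e]
  exact prod_le_prod (fun j _ => by have := P.A_pos j; have := P.one_le_L; positivity)
    fun j _ => P.three_quarters_le j

/-- `(1 + 1/m)^m ≤ e`. [folklore] -/
theorem one_add_div_pow_le_exp_one {m : ℕ} (hm : 0 < m) : (1 + 1 / (m : ℝ)) ^ m ≤ Real.exp 1 := by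
  have h1 : (1 + 1 / (m : ℝ)) ≤ Real.exp (1 / m) := by
    have := Real.add_one_le_exp (1 / (m : ℝ)); linarith
  have hm' : (m : ℝ) ≠ 0 := by positivity
  calc (1 + 1 / (m : ℝ)) ^ m ≤ (Real.exp (1 / m)) ^ m := pow_le_pow_left₀ (by positivity) h1 m
    _ = Real.exp (m * (1 / m)) := (Real.exp_nat_mul _ _).symm
    _ = Real.exp 1 := by rw [mul_one_div_cancel hm']

/-- `(k+1)^k ≤ e^k · k!`. [folklore] -/
theorem succ_pow_le_exp_pow_mul_factorial (k : ℕ) :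
    ((k : ℝ) + 1) ^ k ≤ Real.exp 1 ^ k * (k.factorial : ℝ) := by
  induction k with
  | zero => simp
  | succ k ih =>
    have hk : (0 : ℝ) < k + 1 := by positivity
    have h2 := one_add_div_pow_le_exp_one (m := k + 1) (by omega)
    push_cast at h2
    have e1 : ((k : ℝ) + 1 + 1) ^ (k + 1) = (1 + 1 / ((k : ℝ) + 1)) ^ (k + 1) * ((k : ℝ) + 1) ^ (k + 1) := by
      rw [← mul_pow]; congr 1; field_simp
    rw [Nat.cast_succ, e1, Nat.factorial_succ, Nat.cast_mul, pow_succ, pow_succ]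
    push_cast
    have he : 0 ≤ Real.exp 1 ^ k := by positivity
    calc (1 + 1 / ((k : ℝ) + 1)) ^ (k + 1) * (((k : ℝ) + 1) ^ k * ((k : ℝ) + 1))
        ≤ Real.exp 1 * ((Real.exp 1 ^ k * (k.factorial : ℝ)) * ((k : ℝ) + 1)) := by gcongr
      _ = Real.exp 1 ^ k * Real.exp 1 * (((k : ℝ) + 1) * (k.factorial : ℝ)) := by ring

/-- `C(M'+n, n) ≤ (c e)ⁿ` whenever `M' + n ≤ c (n+1)`. [folklore] -/
theorem choose_le_of_le (M' : ℕ) {c : ℝ} (hc : 0 ≤ c) (hM : (M' : ℝ) + n ≤ c * (n + 1)) :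
    (Nat.choose (M' + n) n : ℝ) ≤ (c * Real.exp 1) ^ n := by
  have h1 : (Nat.choose (M' + n) n : ℝ) ≤ ((M' + n : ℕ) : ℝ) ^ n / (n.factorial : ℝ) :=
    Nat.choose_le_pow_div n (M' + n)
  have hfac : (0 : ℝ) < n.factorial := by positivity
  have h2 : ((M' + n : ℕ) : ℝ) ^ n ≤ (c * ((n : ℝ) + 1)) ^ n := by
    push_cast; exact pow_le_pow_left₀ (by positivity) hM n
  have h3 := succ_pow_le_exp_pow_mul_factorial n
  calc (Nat.choose (M' + n) n : ℝ) ≤ ((M' + n : ℕ) : ℝ) ^ n / (n.factorial : ℝ) := h1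
    _ ≤ (c * ((n : ℝ) + 1)) ^ n / (n.factorial : ℝ) := div_le_div_of_nonneg_right h2 hfac.le
    _ = c ^ n * (((n : ℝ) + 1) ^ n / (n.factorial : ℝ)) := by rw [mul_pow]; ring
    _ ≤ c ^ n * Real.exp 1 ^ n := by
        refine mul_le_mul_of_nonneg_left ?_ (by positivity)
        rw [div_le_iff₀ hfac]; exact h3
    _ = (c * Real.exp 1) ^ n := by rw [mul_pow]

/-- **`C(M'+n, n) ≤ (17 e L)ⁿ` for `M' ≤ Mord 0 0`** (the number of derivative multi-indices).
[cite: Nesterenko2003, (3.48)] -/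
theorem choose_Mord_le {M' : ℕ} (hM : M' ≤ P.Mord 0 0) :
    (Nat.choose (M' + n) n : ℝ) ≤ (17 * P.L * Real.exp 1) ^ n := by
  refine choose_le_of_le M' (by linarith [P.one_le_L]) ?_
  have h1 : (M' : ℝ) ≤ P.Mord 0 0 := by exact_mod_cast hM
  have h2 := P.Mord_zero_zero_le'
  have hL : (2 : ℝ) ^ (n + 24) ≤ P.L := by exact_mod_cast P.two_pow_le_L
  have h24 : (2 : ℝ) ^ 24 ≤ 2 ^ (n + 24) := pow_le_pow_right₀ (by norm_num) (by omega)
  have h0 : (0 : ℝ) ≤ n := by positivity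
  nlinarith

/-- **(B1) THE SIEGEL COUNT**: `2 (2X+1) · C(M'+n, n) · K ≤ (L₀ + 1) · ∏ (2 side j + 1)` for every order
bound `M' ≤ Mord 0 0` — twice as many unknowns `(ℓ₀, λ) ∈ [0, L₀] × 𝔏` (`#𝔏 ≥ #box/K`) as equations
`(x; m₀, m)`, `|x| ≤ X`, `m₀ + |m| ≤ M'`. [cite: Nesterenko2003, Prop 3.9 (3.48)] -/
theorem siegel_count_real {M' : ℕ} (hM : M' ≤ P.Mord 0 0) :
    2 * (2 * (P.X : ℝ) + 1) * (Nat.choose (M' + n) n : ℝ) * P.K ≤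
      ((P.L₀ : ℝ) + 1) * ∏ j, (2 * (P.side j : ℝ) + 1) := by
  have hC := P.choose_Mord_le hM
  have hprod := P.prod_side_ge
  have hL₀ := P.L₀_ge
  have hX : (1 : ℝ) ≤ P.X := by exact_mod_cast P.one_le_X
  have hK := P.K_pos
  have hΩ := P.Ω_pos
  have hL : (0 : ℝ) ≤ P.L := by linarith [P.one_le_L]
  have he : (0 : ℝ) ≤ Real.exp 1 := (Real.exp_pos 1).le
  -- right side ≥ 6 X K (24 e L)ⁿ
  have hR : 6 * P.X * P.K * (24 * P.L * Real.exp 1) ^ n ≤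
      ((P.L₀ : ℝ) + 1) * ∏ j, (2 * (P.side j : ℝ) + 1) := by
    have e2 : Cb * (3 / 4) * P.L = 24 * P.L * Real.exp 1 := by unfold Cb cM; push_cast; ring
    have e : 6 * P.X * Cb ^ n * P.Ω * P.K * ((3 / 4 : ℝ) ^ n * ((P.L : ℝ) ^ n / P.Ω)) =
        6 * P.X * P.K * (24 * P.L * Real.exp 1) ^ n := by
      rw [← e2, mul_pow, mul_pow]
      field_simp
    rw [← e]
    have h0 : 0 ≤ 6 * P.X * Cb ^ n * P.Ω * P.K := by
      have := Cb_pos; have := P.Ω_pos; have := P.K_pos; positivity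
    calc 6 * P.X * Cb ^ n * P.Ω * P.K * ((3 / 4 : ℝ) ^ n * ((P.L : ℝ) ^ n / P.Ω))
        ≤ (P.L₀ : ℝ) * ∏ j, (2 * (P.side j : ℝ) + 1) :=
          mul_le_mul hL₀ hprod (by positivity) (by positivity)
      _ ≤ ((P.L₀ : ℝ) + 1) * ∏ j, (2 * (P.side j : ℝ) + 1) := by
          have : 0 ≤ ∏ j, (2 * (P.side j : ℝ) + 1) := prod_nonneg fun j _ => by positivity
          nlinarith
  -- left side ≤ 6 X K (17 e L)ⁿ ≤ 6 X K (24 e L)ⁿ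
  have h17 : (17 * P.L * Real.exp 1) ^ n ≤ (24 * P.L * Real.exp 1) ^ n :=
    pow_le_pow_left₀ (by positivity) (by nlinarith) n
  have hpow : 0 ≤ (17 * P.L * Real.exp 1) ^ n := by positivity
  calc 2 * (2 * (P.X : ℝ) + 1) * (Nat.choose (M' + n) n : ℝ) * P.K
      ≤ 2 * (2 * (P.X : ℝ) + 1) * (17 * P.L * Real.exp 1) ^ n * P.K := by gcongr
    _ ≤ 6 * P.X * P.K * (17 * P.L * Real.exp 1) ^ n := by nlinarith [mul_nonneg hpow hK.le]
    _ ≤ 6 * P.X * P.K * (24 * P.L * Real.exp 1) ^ n := by gcongr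
    _ ≤ _ := hR

/-- **(B1) in natural numbers** — the hypothesis `2·#eqs ≤ #unk` of `G3Setup.siegel_slab` once
`#midx M' ≤ C(M'+n, n)` and `∏ (2 side j + 1) ≤ K · #𝔏`. [cite: Nesterenko2003, Prop 3.9 (3.48)] -/
theorem siegel_count {M' : ℕ} (hM : M' ≤ P.Mord 0 0) :
    2 * (2 * P.X + 1) * Nat.choose (M' + n) n * P.K ≤ (P.L₀ + 1) * ∏ j, (2 * P.side j + 1) := by
  have h := P.siegel_count_real hM
  exact_mod_cast h

end PadicG3Par

end Summit.ABC.StewartYu
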